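import Summits.PneNP.PneNP.Theses.KrwChromaticSteering

/-!
# Birth skeleton (BC3) — crux `StrongComposition` of route `KrwChromaticSteering` (item stmt-PneNP-18538)

The crux (verbatim, `Summit.PneNP.PneNP.Theses.KrwChromaticSteering.StrongComposition`):
strong composition with `γ = 1` —
`∃ c, ∀ m n, 1 ≤ n → ∀ f` non-constant `∃ g, ∀ P : KWTree (Fin m × Fin n), P.SolvesStrong f g →
 ∃ Q : KWTree (Fin m), Q.Solves f ∧ Q.depth + n ≤ P.depth + c * (Nat.log 2 (m * n) + 1)`.

## The line (Meir 2023, arXiv:2306.00615, §3–4, with γ raised from 0.04 to 1 by STEERING)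

Negating the crux for a fixed `(m, n, f)` hands us, for EVERY inner function `g`, a cheap standard
protocol `F g` for `KW_f ⊛ KW_g`; write `d := max_g depth (F g)`.  Such a FAMILY
`F : ((Fin n → Bool) → Bool) → KWTree (Fin m × Fin n)` is exactly the data of Meir's Lemma 6
protocol for the multiplexor game `KW_f ⊛ MUX_n` (Alice runs `F g_A` on `(g_A, X)`, Bob runs
`F g_B` on `(g_B, Y)`; all rounds are classical when `g_A = g_B`), so the partially-half-duplex
machinery (Meir Def. 15–19) is needed here ONLY through the per-player CONSISTENCY of an input with
a bit string `π` read along the player's own tree (`AliceConsistent`, `BobConsistent` below: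
structural descent; at an own node the sent bit must match, at the other player's node any bit is
received; past a leaf everything is consistent).  Over these we type Meir's Notation 3 objects
`𝒳_π(g)`, `𝒴_π(g)`, `𝒜_π(g)`, `ℬ_π(g)`, `𝒱_π` (`Xset`, `Yset`, `Aset`, `Bset`, `Alive`), the
characteristic graph of Def. 22 (`charGraph`, weak intersection property `WIP`, on the vertex type of
ALL inner functions — a supergraph of Meir's graph on `𝒱_π`, which only raises `χ` and leaves
Lemma 8 intact) and `chi := χ(G_π)` (`SimpleGraph.chromaticNumber`, as a natural number).

Stubs (sorried, named; the first two are PRINTED/PROVABLE, the third is the LEVER and is open):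

* `stub_residualRectangle` (M) — at any bit string `π` the residual protocol of `F g` (the subtree
  reached along `π`, fed with consistent witnesses of the labels) solves `KW_f` on the live label
  rectangle `𝒜_π(g) × ℬ_π(g)` within the remaining depth: `∃ R, SolvesOn R 𝒜 ℬ ∧ |π| + depth R ≤ d`
  (Meir §3.3, "the protocol obtained by hard-wiring g"; definition of `⊛`).
* `stub_chromaticEndgame` (L) — Meir's Lemma 8 in family form, Lemma 6 absorbed into the constant:
  `|π| + log₂ log₂ χ(G_π) ≤ d + c·(log₂(mn)+1)` for every family solving the strong games within
  depth `d` and every `|π| ≤ d` (co-nondeterministic graph-inequality protocol from the residual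
  execution: classical continuation + Alice's leaf verification, or the first non-classical /
  leaf-mismatch round; `χ ≤ 2^(#witnesses)`; the `log c` term is absorbed by the case split
  `c ≥ log log χ` as in the printed proof, using `χ ≤ 2^(2^n)`).
* `stub_steeredTranscript` (XL, THE LEVER, open) — the steered structure theorem at `γ = 1` in its
  weakest consumed (certificate / dichotomy) form: for every family `F` within depth `d` there is a
  bit string `π`, `|π| ≤ d`, at which EITHER some live `g` has a residual label rectangle that is
  still `KW_f`-hard up to the bits spent minus `n` (`∀ R` solving `𝒜_π(g) × ℬ_π(g)`,
  `C(KW_f) + n ≤ |π| + depth R + c·L`), OR the chromatic potential certifies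
  (`C(KW_f) + n ≤ |π| + log₂ log₂ χ(G_π) + c·L`), `L = log₂(mn)+1`.

`strongComposition_of_sigs` PROVES (no sorry) that the three stub STATEMENTS imply the crux BODY
(by contradiction: choose the family of counterexample protocols, `d` = the maximal depth, attained
at `g₀`; both branches of the dichotomy give a `KW_f` tree `Q` with `depth Q + n ≤ d + (c₁+c₂)·L`,
contradicting the counterexample inequality at `g₀`).  `StrongComposition_of` concludes the crux
BY NAME from the three stubs by name (A12 registrar shape); `sorry` occurs only inside `stub_*`.

Transfer / honesty note.  `StrongComposition ⇒ SteeredTranscript` is cheap (pad `π` to length `d`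
and use the right disjunct), and `SteeredTranscript ⇒ StrongComposition` is this file given the two
printed stubs: the lever is the crux in Meir's structure-theorem COORDINATES, which is the point of
the line — it exposes the two one-bit potentials the steering must trade off: `x_π(g) = C(𝒜_π(g) ×
ℬ_π(g))` (sub-additive under a label split: `C((A₀ ∪ A₁) × B) ≤ 1 + max_b C(A_b × B)`) and
`y_π = log₂ log₂ χ(G_π)` (`χ(G_π) ≤ 2·χ(G_{π0})·χ(G_{π1})`: witnesses split between the children
except at conflict rounds, whose graph is bipartite by the node type at `π`).  Disproof honoured: the
non-constancy of `f` and `1 ≤ n` are hypotheses of the lever (`strongComposition_false_without_nonconst`,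
`strongComposition_n0_vacuous`); Meir's Prop. 9 (a 0.64-live transcript with `χ(G_π) = 1`) is not
a counterexample to the dichotomy, which quantifies `∃ π` (steered), not `∀` live `π`.
-/

set_option linter.dupNamespace false
set_option autoImplicit false

namespace Summit.PneNP.PneNP.Cruxes.StrongComposition.Birth

open Literature.Computability.Complexity
open Summit.PneNP.PneNP.Theses.KrwChromaticSteering

universe u

/-! ### Per-player consistency of an input with a bit string, read along a standard tree -/

section Transcripts

variable {ι : Type u}

/-- `AliceConsistent P x π`: reading the bit string `π` down the tree `P`, at every ALICE node met
the bit Alice would send on input `x` is the next bit of `π` (at Bob nodes she receives whatever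
`π` says; once a leaf is reached the rest of `π` is unconstrained).  This is Meir's "the input
`(g_A, X)` is consistent with `π`" (Def. 17 / Notation 2) for the Lemma-6 protocol of a family,
read on Alice's own tree `F g_A`. [cite: Meir2023, Def. 17, Notation 2–3] -/
def AliceConsistent : KWTree ι → (ι → Bool) → List Bool → Prop
  | _, _, [] => True
  | KWTree.leaf _, _, _ :: _ => True
  | KWTree.alice s P _, x, false :: π => s x = false ∧ AliceConsistent P x π
  | KWTree.alice s _ Q, x, true :: π => s x = true ∧ AliceConsistent Q x π
  | KWTree.bob _ P _, x, false :: π => AliceConsistent P x π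
  | KWTree.bob _ _ Q, x, true :: π => AliceConsistent Q x π

/-- `BobConsistent P y π`: the same for Bob — at every BOB node met along `π` the bit Bob would
send on input `y` is the next bit of `π`. [cite: Meir2023, Def. 17, Notation 2–3] -/
def BobConsistent : KWTree ι → (ι → Bool) → List Bool → Prop
  | _, _, [] => True
  | KWTree.leaf _, _, _ :: _ => True
  | KWTree.alice _ P _, y, false :: π => BobConsistent P y π
  | KWTree.alice _ _ Q, y, true :: π => BobConsistent Q y π
  | KWTree.bob s P _, y, false :: π => s y = false ∧ BobConsistent P y π
  | KWTree.bob s _ Q, y, true :: π => s y = true ∧ BobConsistent Q y π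

end Transcripts

/-! ### Families of strong-game protocols and Meir's transcript objects -/

section Family

/-- A FAMILY of standard protocols for the strong games `KW_f ⊛ KW_g`, one tree per inner function
`g` — the data of Meir's Lemma-6 protocol for `KW_f ⊛ MUX_n`. [cite: Meir2023, Lemma 6 (§3.1)] -/
abbrev Family (m n : ℕ) : Type := ((Fin n → Bool) → Bool) → KWTree (Fin m × Fin n)

variable {m n : ℕ}

/-- `𝒳_π(g)`: Alice's matrices `X ∈ (f ⋄ g)⁻¹(1)` consistent with `π` along `F g`.
[cite: Meir2023, Notation 3] -/
def Xset (f : (Fin m → Bool) → Bool) (F : Family m n) (π : List Bool) (g : (Fin n → Bool) → Bool) :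
    Set (Fin m × Fin n → Bool) :=
  {X | blockComp f g X = true ∧ AliceConsistent (F g) X π}

/-- `𝒴_π(g)`: Bob's matrices `Y ∈ (f ⋄ g)⁻¹(0)` consistent with `π` along `F g`.
[cite: Meir2023, Notation 3] -/
def Yset (f : (Fin m → Bool) → Bool) (F : Family m n) (π : List Bool) (g : (Fin n → Bool) → Bool) :
    Set (Fin m × Fin n → Bool) :=
  {Y | blockComp f g Y = false ∧ BobConsistent (F g) Y π}

/-- `𝒜_π(g) ⊆ f⁻¹(1)`: the label columns `g(X)` of the matrices in `𝒳_π(g)`. [cite: Meir2023, Notation 3] -/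
def Aset (f : (Fin m → Bool) → Bool) (F : Family m n) (π : List Bool) (g : (Fin n → Bool) → Bool) :
    Set (Fin m → Bool) :=
  rowLabels g '' Xset f F π g

/-- `ℬ_π(g) ⊆ f⁻¹(0)`: the label columns `g(Y)` of the matrices in `𝒴_π(g)`. [cite: Meir2023, Notation 3] -/
def Bset (f : (Fin m → Bool) → Bool) (F : Family m n) (π : List Bool) (g : (Fin n → Bool) → Bool) :
    Set (Fin m → Bool) :=
  rowLabels g '' Yset f F π g

/-- `𝒱_π`: the LIVE inner functions at `π` — both label sides non-empty. [cite: Meir2023, Notation 3] -/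
def Alive (f : (Fin m → Bool) → Bool) (F : Family m n) (π : List Bool) : Set ((Fin n → Bool) → Bool) :=
  {g | (Aset f F π g).Nonempty ∧ (Bset f F π g).Nonempty}

/-- The WEAK INTERSECTION PROPERTY of `(g_A, g_B)` at `π`: some `X ∈ 𝒳_π(g_A)`, `Y ∈ 𝒴_π(g_B)` agree
on every row whose labels `a_i = g_A(X_i)`, `b_i = g_B(Y_i)` differ. [cite: Meir2023, Def. 22] -/
def WIP (f : (Fin m → Bool) → Bool) (F : Family m n) (π : List Bool)
    (gA gB : (Fin n → Bool) → Bool) : Prop :=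
  ∃ X ∈ Xset f F π gA, ∃ Y ∈ Yset f F π gB,
    ∀ i : Fin m, rowLabels gA X i ≠ rowLabels gB Y i → row X i = row Y i

/-- Meir's CHARACTERISTIC GRAPH `G_π` of the strong multiplexor game, on the type of ALL inner
functions: two distinct functions are adjacent iff the weak intersection property holds in one of
the two orders.  (Meir takes the induced subgraph on the live functions `𝒱_π`; dropping that
restriction can only RAISE `χ`, and Lemma 8's covering argument never uses liveness, so the
endgame stub stays true while the lever's y-certificate gets weaker = easier; it also makes the
one-bit law `χ(G_π) ≤ 2·χ(G_{π0})·χ(G_{π1})` clean.) [cite: Meir2023, Def. 22] -/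
def charGraph (f : (Fin m → Bool) → Bool) (F : Family m n) (π : List Bool) :
    SimpleGraph ((Fin n → Bool) → Bool) where
  Adj gA gB := gA ≠ gB ∧ (WIP f F π gA gB ∨ WIP f F π gB gA)
  symm := ⟨fun _ _ h => ⟨fun h' => h.1 h'.symm, h.2.symm⟩⟩
  loopless := ⟨fun _ h => h.1 rfl⟩

/-- `χ(G_π)` as a natural number (the vertex type is finite, so the chromatic number is finite and
`≥ 1`). [cite: Meir2023, Lemma 8] -/
noncomputable def chi (f : (Fin m → Bool) → Bool) (F : Family m n) (π : List Bool) : ℕ :=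
  (charGraph f F π).chromaticNumber.toNat

/-- `SolvesOn Q A B`: the `KW_f`-type tree `Q` solves the Karchmer–Wigderson game on the rectangle
`A × B` (outputs a differing coordinate on every `a ∈ A`, `b ∈ B`); `C(A × B)` is the least depth of
such a tree. [cite: Meir2023, §2.3 (KW relations of rectangles, `KW_{A×B}`)] -/
def SolvesOn (Q : KWTree (Fin m)) (A B : Set (Fin m → Bool)) : Prop :=
  ∀ a ∈ A, ∀ b ∈ B, a (Q.run a b) ≠ b (Q.run a b)

end Family

/-! ### The three stub statements -/

/-- Statement of `stub_residualRectangle`. -/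
def ResidualRectangle : Prop :=
  ∀ (m n : ℕ) (f : (Fin m → Bool) → Bool) (F : Family m n) (d : ℕ) (π : List Bool)
    (g : (Fin n → Bool) → Bool),
    (F g).SolvesStrong f g → (F g).depth ≤ d → π.length ≤ d →
      ∃ R : KWTree (Fin m), SolvesOn R (Aset f F π g) (Bset f F π g) ∧ π.length + R.depth ≤ d

/-- Statement of `stub_chromaticEndgame`. -/
def ChromaticEndgame : Prop :=
  ∃ c : ℕ, ∀ (m n : ℕ) (f : (Fin m → Bool) → Bool) (F : Family m n) (d : ℕ) (π : List Bool),
    (∀ g, (F g).SolvesStrong f g) → (∀ g, (F g).depth ≤ d) → π.length ≤ d →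
      π.length + Nat.log 2 (Nat.log 2 (chi f F π)) ≤ d + c * (Nat.log 2 (m * n) + 1)

/-- Statement of `stub_steeredTranscript` (the lever). -/
def SteeredTranscript : Prop :=
  ∃ c : ℕ, ∀ (m n : ℕ), 1 ≤ n → ∀ f : (Fin m → Bool) → Bool, (∃ a b, f a ≠ f b) →
    ∀ (F : Family m n) (d : ℕ), (∀ g, (F g).SolvesStrong f g) → (∀ g, (F g).depth ≤ d) →
      ∃ π : List Bool, π.length ≤ d ∧
        ((∃ g ∈ Alive f F π, ∀ R : KWTree (Fin m), SolvesOn R (Aset f F π g) (Bset f F π g) →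
            ∃ Q : KWTree (Fin m), Q.Solves f ∧
              Q.depth + n ≤ π.length + R.depth + c * (Nat.log 2 (m * n) + 1)) ∨
          (∃ Q : KWTree (Fin m), Q.Solves f ∧
              Q.depth + n ≤ π.length + Nat.log 2 (Nat.log 2 (chi f F π)) + c * (Nat.log 2 (m * n) + 1)))

/-! ### The stubs (named, sorried) -/

/-- STUB (provable, M) — THE RESIDUAL PROTOCOL SOLVES THE LIVE LABEL RECTANGLE: the subtree of `F g`
reached along `π`, run on consistent witnesses `X_a ∈ 𝒳_π(g)` of `a ∈ 𝒜_π(g)` and `Y_b ∈ 𝒴_π(g)` of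
`b ∈ ℬ_π(g)` (a `comap` with `Prod.fst`), follows the run of `F g` on `(X_a, Y_b)` (both consistent
with `π`), and `SolvesStrong` makes the answer's ROW one with `a_i ≠ b_i`; its depth is the remaining
depth `≤ d − |π|` (or `0` past a leaf). [cite: Meir2023, §3.3 (hard-wiring `g`; the residual game is
`KW_f` on `𝒜 × ℬ`), Def. 12] -/
theorem stub_residualRectangle :
    ∀ (m n : ℕ) (f : (Fin m → Bool) → Bool) (F : Family m n) (d : ℕ) (π : List Bool)
      (g : (Fin n → Bool) → Bool),
      (F g).SolvesStrong f g → (F g).depth ≤ d → π.length ≤ d →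
        ∃ R : KWTree (Fin m), SolvesOn R (Aset f F π g) (Bset f F π g) ∧ π.length + R.depth ≤ d := by
  sorry

/-- STUB (provable, L) — MEIR'S LEMMA 8 IN FAMILY FORM (Lemma 6 absorbed): for a family solving the
strong games within depth `d` and any `|π| ≤ d`, `|π| + log₂ log₂ χ(G_π) ≤ d + c·(log₂(mn)+1)`.
Proof: a diagonal-free rectangle cover of the edges of `G_π` by `2^k` rectangles,
`k ≤ (d − |π|) + log₂(d − |π|) + log₂(mn) + O(1)` (Merlin names the order of the weak intersection,
then either the classical continuation `π₂` of the residual execution on the witnesses `(X, Y)` with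
Alice's leaf bits `X_{ij}, a_i` — refuted on the diagonal by `SolvesStrong` of the common tree — or the
index of the first wasted / silent / leaf-mismatch round, impossible on the diagonal where both players
read the same tree), whence `χ ≤ 2^(2^k)`; the `log₂(d − |π|)` is removed by the case split
`d − |π| ≥ log₂ log₂ χ` (trivial) vs `< log₂ log₂ χ ≤ n` (`χ ≤ 2^(2^n)`).
[cite: Meir2023, Lemma 8 and its proof (§4.2), Prop. 7, Lemma 6; MihajlinSmal2021] -/
theorem stub_chromaticEndgame :
    ∃ c : ℕ, ∀ (m n : ℕ) (f : (Fin m → Bool) → Bool) (F : Family m n) (d : ℕ) (π : List Bool),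
      (∀ g, (F g).SolvesStrong f g) → (∀ g, (F g).depth ≤ d) → π.length ≤ d →
        π.length + Nat.log 2 (Nat.log 2 (chi f F π)) ≤ d + c * (Nat.log 2 (m * n) + 1) := by
  sorry

/-- STUB (THE LEVER, XL, open) — THE STEERED STRUCTURE THEOREM AT `γ = 1`, dichotomy form: for every
non-constant `f`, `n ≥ 1` and every family `F` within depth `d` there is a bit string `π`, `|π| ≤ d`,
where either (x-certificate) some live `g` has a residual label rectangle from which every solver `R`
yields a `KW_f` tree `Q` with `depth Q + n ≤ |π| + depth R + c·L`, or (y-certificate) a `KW_f` tree `Q`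
with `depth Q + n ≤ |π| + log₂ log₂ χ(G_π) + c·L`.  This is what a steered walk keeping
`|π| + max(x_π, y_π) ≥ C(KW_f) + n − O(log mn)` would deliver; Meir proves the `γ = 0.04` analogue
(Thm. 3.2 + §3.3) and records (§7, Prop. 9) that mass-liveness alone fails at `γ ≥ 0.64`.
[cite: Meir2023, Thm. 3.2, §3.3, §7 Prop. 9; KarchmerRazWigderson1995; DinurMeir2016] -/
theorem stub_steeredTranscript :
    ∃ c : ℕ, ∀ (m n : ℕ), 1 ≤ n → ∀ f : (Fin m → Bool) → Bool, (∃ a b, f a ≠ f b) →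
      ∀ (F : Family m n) (d : ℕ), (∀ g, (F g).SolvesStrong f g) → (∀ g, (F g).depth ≤ d) →
        ∃ π : List Bool, π.length ≤ d ∧
          ((∃ g ∈ Alive f F π, ∀ R : KWTree (Fin m), SolvesOn R (Aset f F π g) (Bset f F π g) →
              ∃ Q : KWTree (Fin m), Q.Solves f ∧
                Q.depth + n ≤ π.length + R.depth + c * (Nat.log 2 (m * n) + 1)) ∨
            (∃ Q : KWTree (Fin m), Q.Solves f ∧
                Q.depth + n ≤
                  π.length + Nat.log 2 (Nat.log 2 (chi f F π)) + c * (Nat.log 2 (m * n) + 1))) := by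
  sorry

/-! ### Composition (kernel-checked, no sorry) -/

/-- COMPOSITION, implication form (no sorry, no stub used): the three stub STATEMENTS imply the crux
BODY.  By contradiction: if for every `g` some protocol `F g` for `KW_f ⊛ KW_g` beats every `KW_f`
tree by more than `(c₁ + c₂)·L − n`, let `d` be the largest depth in the family, attained at `g₀`;
the steered transcript's x-branch (with the residual protocol) or y-branch (with the chromatic
endgame) produces a `KW_f` tree `Q` with `depth Q + n ≤ d + (c₁ + c₂)·L = depth (F g₀) + (c₁ + c₂)·L`,
contradicting the choice of `F g₀`. -/
theorem strongComposition_of_sigs (hRR : ResidualRectangle) (hCE : ChromaticEndgame)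
    (hST : SteeredTranscript) :
    ∃ c : ℕ, ∀ m n : ℕ, 1 ≤ n → ∀ f : (Fin m → Bool) → Bool, (∃ a b, f a ≠ f b) →
      ∃ g : (Fin n → Bool) → Bool, ∀ P : KWTree (Fin m × Fin n), P.SolvesStrong f g →
        ∃ Q : KWTree (Fin m), Q.Solves f ∧ Q.depth + n ≤ P.depth + c * (Nat.log 2 (m * n) + 1) := by
  obtain ⟨c₁, hST⟩ := hST
  obtain ⟨c₂, hCE⟩ := hCE
  refine ⟨c₁ + c₂, fun m n hn f hf => ?_⟩
  by_contra hcon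
  push Not at hcon
  choose F hF hlt using hcon
  obtain ⟨g₀, -, hg₀⟩ :=
    Finset.exists_max_image (Finset.univ : Finset ((Fin n → Bool) → Bool)) (fun g => (F g).depth)
      Finset.univ_nonempty
  have hdepth : ∀ g, (F g).depth ≤ (F g₀).depth := fun g => hg₀ g (Finset.mem_univ g)
  have hsplit : (c₁ + c₂) * (Nat.log 2 (m * n) + 1)
      = c₁ * (Nat.log 2 (m * n) + 1) + c₂ * (Nat.log 2 (m * n) + 1) := by
    ring
  have key : ∃ Q : KWTree (Fin m), Q.Solves f ∧
      Q.depth + n ≤ (F g₀).depth + (c₁ + c₂) * (Nat.log 2 (m * n) + 1) := by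
    obtain ⟨π, hπ, hcase⟩ := hST m n hn f hf F (F g₀).depth hF hdepth
    rcases hcase with ⟨g, -, hleft⟩ | ⟨Q, hQ, hQd⟩
    · obtain ⟨R, hR, hRd⟩ := hRR m n f F (F g₀).depth π g (hF g) (hdepth g) hπ
      obtain ⟨Q, hQ, hQd⟩ := hleft R hR
      exact ⟨Q, hQ, by omega⟩
    · have hce := hCE m n f F (F g₀).depth π hF hdepth hπ
      exact ⟨Q, hQ, by omega⟩
  obtain ⟨Q, hQ, hQd⟩ := key
  have hbad := hlt g₀ Q hQ
  omega

/-- THE SKELETON THEOREM (A12 shape): concludes the crux BY NAME from the three declared stubs by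
name; its only debt is the three `stub_*` sorries (no direct sorry here). -/
theorem StrongComposition_of :
    Summit.PneNP.PneNP.Theses.KrwChromaticSteering.StrongComposition :=
  strongComposition_of_sigs stub_residualRectangle stub_chromaticEndgame stub_steeredTranscript

end Summit.PneNP.PneNP.Cruxes.StrongComposition.Birth
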